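import Summits.CriticalPhenomena.CardyFormulaZ2.Theorems.CardyMagicRigidityPinchResamplingDefs
import Literature.Probability.Percolation.FiveArmLowerBound
import Literature.Probability.Percolation.ZdFourArmFromFiveArm
import Literature.Probability.RandomPlanarGeometry.CurveMonotoneReparam
import Literature.Probability.RandomPlanarGeometry.LoopDistanceParametrisation
import HarnessLib

/-!
# Vocabulary v3 of line `pinch-resampling` for crux `NestingRigidity` (stmt-CriticalPhenomena-4835): five-arm upper bounds, no-neck rigidity

Route `CardyMagicRigidity` (sub-problem `CriticalPhenomena/CardyFormulaZ2`), crux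
`Summit.CriticalPhenomena.CardyFormulaZ2.Theses.CardyMagicRigidity.NestingRigidity ≡ MagicFormulaZ2 → MagicFormulaT → LoopLimitZ2EqT`.
Definitions ADDENDUM (companion of `CardyMagicRigidityPinchResamplingDefs.lean`, p142657) for the lead reshape v3 of the checked
skeleton `Cruxes/NestingRigidity/Lines/pinch_resampling.lean` (lead seat c5-0, 2026-08-17; `ledger skeleton check` OK 77c74d72;
registered stubs `stub_blindRigidity`, `stub_fiveArmUpperT`, `stub_fiveArmUpperZ2`, `stub_noNeckRigidity`, `stub_neckTomography`).

WHY v3 (mechanism audit `S4-audit.md`, item evidence): the v2 locality stubs `FourArmCouplingT` / `FourArmCouplingZ2` (GPS-type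
exterior forgetting at a deep gadget) are true but NOT consumed by the neck-tomography transfer — conditionally on the full
exterior the routing law of a neck region is the 4-arc crossing probability EXACTLY (product measure); what the transfer consumes is
(a) the published two-radii five-arm UPPER bounds on both lattices (six-arm bounds for the good events via Reimer), (b) a
lattice-free NO-NECK RIGIDITY lemma for planar arcs (Hausdorff-close + neck-free ⇒ reparametrisation-close), and (c), still
inside the transfer stub, blob-graph structure + coarse-measurability of neck hook-up probabilities.  This module carries,
sorry-free: §1 the three v3 stub STATEMENTS `FiveArmUpperT`, `FiveArmUpperZ2`, `NoNeckRigidity` (with `NeckFree`) verbatim from the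
registered skeleton; §2 glue: the six-arm consequence `sixArm_le_of_fiveArmUpperT`, the classical special case
`reparamDist_le_of_noNeckRigidity`, and the registered composition `nestingRigidity_of_stubs_v3` (anchor on the crux item).
Nothing here is asserted: every `def … : Prop` is a statement to be proved by a registered stub.
-/

noncomputable section

namespace Summit.CriticalPhenomena.CardyFormulaZ2.Cruxes.NestingRigidity.PinchResampling

open Summit.CriticalPhenomena.CardyFormulaZ2.Theses.CardyMagicRigidity
open MeasureTheory Literature.Probability.Percolation Literature.Probability.LatticeModels
  Literature.Probability.RandomPlanarGeometry

/-! ## §1 Vocabulary v3 (verbatim §0' of the registered skeleton) -/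

/-- **`FiveArmUpperT` — the two-radii five-arm UPPER bound for critical site percolation on `𝕋`** (stub S5; a published
theorem absent from the tree, which has only the matching LOWER bound `fiveArm_lowerBound`): there are `C` and `m₀` with
`P_{1/2}(armEvent (T,F,T,F,F) m n) ≤ C (m/n)²` for all `m₀ ≤ m ≤ n` — EXACTLY the event and colour sequence of
`fiveArm_lowerBound` at `t = 1/2`, so that the two bounds sandwich one quantity.  Sources: P. Nolin, *Near-critical percolation in
two dimensions*, EJP 13 (2008), §5.2 Thm. 24, five-arm item (cited in the tree as Thm. 24 (ii); arXiv 0711.4948 Thm. 23: "for any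
non-constant `σ ∈ 𝔖̃₅`, `P_{1/2}(A_{5,σ}(0,N)) ≍ N^{-2}`", proof "by color switching it is sufficient to prove the claim for
`σ = BWBBW`" + "`A_v` can occur for at most one site `v`"), two radii by quasi-multiplicativity (ibid. Prop. 17 [arXiv Prop. 16],
display `C (n/N)^{α_j} ≤ π_j(n|N)`, `π_j(n₁|n₂) π_j(n₂|n₃) ≍ π_j(n₁|n₃)`); H. Kesten, V. Sidoravicius, Y. Zhang, EJP 3 (1998),
Lemma 5; W. Werner, PCMI 2009, Lecture 6 §3 and first exercise sheet "Five-arm exponent".  The tree's `armEvent` imposes NO cyclic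
order, so `armEvent (T,F,T,F,F) m n` is the finite union of the cyclically ordered events `BWBWW`, `BBWWW` (two open, three closed
arms); each is `≍` Nolin's `σ₅` by the colour exchange trick (ibid. §5.1, arXiv Prop. 19: "`P_{1/2}(A_{j,σ}) ≍ P_{1/2}(A_{j,σ'})`
for non-constant `σ, σ'`") and the colour flip `p ↔ 1 - p` at `p = 1/2` (`real_armEvent_TFTFF_eq_symm`, `symm_half`), whence the
statement.  DECISION (design note §2): one fixed `κ` suffices for the transfer — the six-arm bound of the good events G1 ("no neck
region with three macroscopic strands": six interface crossings of `A(x; r, θ)` = six alternating arms) and G2 ("no `ε`-shadows")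
is `P(armEvent (T,F,T,F,F,T) m n) ≤ P(armEvent (T,F,T,F,F) m n) · P(armEvent (T) m n) ≤ C C₁ (m/n)^{2+α}` by Reimer
(`real_armEvent_append_le_mul half _ ![true]`) and the one-arm bound `exists_polyArmProb_one_le_rpow`; see
`sixArm_le_of_fiveArmUpperT` (§4, sorry-free); the order-free event `armEvent (T,F,T,F,F,T)` contains every cyclic arrangement of
three open and three closed arms (`armEvent_comp_equiv`).  Degenerate values: `m = 0` gives `armEvent _ 0 n = ∅` (five
vertex-disjoint arms from the one site of `∂Λ₀`), `m = n` needs `C ≥ 1`; `C` is not required positive (consumers take `max C 1`). -/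
def FiveArmUpperT : Prop :=
  ∃ C : ℝ, ∃ m₀ : ℕ, ∀ m n : ℕ, m₀ ≤ m → m ≤ n →
    (triSitePercolation half).real (armEvent ![true, false, true, false, false] m n) ≤ C * ((m : ℝ) / n) ^ 2

/-- **`FiveArmUpperZ2` — the two-radii five-arm UPPER bound for critical bond percolation on `ℤ²`** (stub S6; published, absent
from the tree): `P_{1/2}(zdFiveArmClusters m n) ≤ C (m/n)²` for `m₀ ≤ m ≤ n`, for the tree's CLUSTER-FORM five-arm event
`zdFiveArmClusters` (`ZdFourArmFromFiveArm.lean`: three open crossings `W₁, W₂, W₃` of the square annulus `A_{m,n}`, `W₃`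
edge-disjoint from `W₁, W₂`, the inner ends of `W₁, W₂` NOT joined by an open path of the annulus — cyclic pattern `σ₅ = (o c o c o)
= BWBBW`, the two closed dual arms being automatic).  This is the event whose LOWER bound is the missing input of the tree's
`fourArm_lowerBound_of_fiveArm_oneArm`, and the one that feeds the `ℤ²` six-arm bound of the transfer: a six-arm cluster event
(three pairwise distinct open crossing clusters) is contained in `zdFiveArmClusters m n □ (a closed dual crossing)` (factor out the
dual arm between the second and third cluster; the first two stay separated by the other two dual arms), so Reimer `reimer_holds`
(as in `zdFiveArmClusters_subset_disjointOccurrence`, `real_zdFiveArmClusters_le`) and the dual one-arm bound (`ZdOneArmPowerBound`)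
give exponent `2 + α`.  Sources: Nolin 2008 (above), Thm. 24 five-arm item with arXiv Rem. 25: "these estimates for critical and
near-critical percolation remain valid on other lattices too, like the square lattice — at least for the color sequences that we
have used in the proofs" (`σ = BWBBW` is the one used; the uniqueness argument "`A_v` can occur for at most one `v`" uses only that
open arms and closed DUAL arms never cross, so edge-disjointness of `W₃` is enough); Kesten–Sidoravicius–Zhang 1998 Lemma 5; Kesten,
CMP 109 (1987) (arm separation / quasi-multiplicativity on `ℤ²` for the passage to two radii); the tree's own "β₃ = 2 by counting"
in `…BigLoopsTightZ2`.  Degenerate values: `siteSphere 0 = ∅` so `zdFiveArmClusters 0 n = ∅`; `m = n ≥ 1` has probability `≤ 1 ≤ C`. -/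
def FiveArmUpperZ2 : Prop :=
  ∃ C : ℝ, ∃ m₀ : ℕ, ∀ m n : ℕ, m₀ ≤ m → m ≤ n →
    (bondPercolation (zdGraph 2) half).real (zdFiveArmClusters m n) ≤ C * ((m : ℝ) / n) ^ 2

/-- **Neck-freeness of a parametrised planar curve at scales `(r, θ)`** ("no `(r, θ)`-neck", the ARC notion of audit §5 iv.4):
whenever two points of the curve are within distance `r`, the sub-arc between them has diameter `≤ θ`.  Equivalently: the curve
never returns within `r` of a point after an excursion of diameter `> θ`; for `r ≤ θ` wiggles of diameter `≤ θ` are unrestricted.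
In the transfer this holds (with `r ≪ θ = η/20`) for every FREE ARC of a macroscopic loop — a sub-arc off the neck regions whose
complement in the loop has diameter `> θ` — because off the regions two `θ`-separated strands are never `r`-close (definition of the
regions) and the small complementary arc cannot be the big complement.  Applied to a closed curve (`a 0 = a 1`) it forces
`diam (range a) ≤ θ`; the loop notion "one of the two complementary arcs is `θ`-small" is deliberately NOT introduced (the transfer
cuts loops into free arcs, see `NoNeckRigidity`).  Monotone: weaker for smaller `r` and for larger `θ`; invariant under
`Curve.reverse` and under reparametrisation. -/
def NeckFree (r θ : ℝ) (a : Curve ℂ) : Prop :=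
  ∀ s t : unitInterval, dist (a s) (a t) ≤ r → Metric.diam (a '' Set.uIcc s t) ≤ θ

/-- **`NoNeckRigidity` — no-neck rigidity of planar arcs (stub S9; lattice-free, deterministic; brick D2 of audit §5 iv.4, RE-TYPED).**
For curves `a b : Curve ℂ` and scales `2ε < r`, `0 ≤ ζ`: if `a` and `b` are `(r, θ)`-neck-free, `b` lies in the closed `ε`-tube of
`a` (H1), every point of `a` is within `ε` of `b` except possibly points within `ζ` of an endpoint of `a` (H2), and `b` is ANCHORED
at both ends — `b 0` is within `ε` of a point `a s₀` whose initial arc `a[0, s₀]` has diameter `≤ θ`, and symmetrically at `1` (A0/A1)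
— then the ORIENTED reparametrisation distance (`Curve.reparamDist`, increasing homeomorphisms of `[0,1]`; Aizenman–Burchard 1999
§2.1) satisfies `reparamDist a b ≤ 20 (θ + ζ + ε)`.
WHY THIS FORM.  (1) The audit's one-liner "`d_H ≤ ε`, endpoints `ε`-close, both neck-free, `3ε < r` ⇒ Fréchet `≤ 4θ + 4ε`" is the
special case `ζ = 0`, `s₀ = 0`, `s₁ = 1` (`reparamDist_le_of_noNeckRigidity`, §4; the proof below gives `9θ + 9ε` there), but its
ONE-sided weakening (only `b` in the tube of `a`) is FALSE at the audit's own scales `r ≪ θ`: `a` = dense vertical oscillation of amplitude `θ/3` progressing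
east over length `D` (neck-free), `b` = a Z inside that band (east along the top, west along the bottom, east along the middle,
lanes `θ/3 > r` apart: neck-free, in the `ε`-tube of `a`, same endpoints), `reparamDist ≈ D/2`; two-sidedness (H2) kills it (`a`
is `θ/6`-far from `b` between the lanes).  (2) Reversal `b = a.reverse` of a big arc returning within `d ∈ (r, θ]` of its start is
Hausdorff-`0`-close with endpoints `d`-close: endpoint control must be FINER than `r`, whence anchors at precision `ε` (A0/A1); they
also absorb the end effects of the transfer, where `b` is a tube component of the partner loop whose ends are only known to have fine
shadows in the initial/final `θ`-arcs of `a`, and the exemption radius `ζ` in (H2) (`= 3θ + 2ε` there) covers the points of `a`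
near its ends that such a component need not visit.  (3) `b` winding twice, or backtracking by `> θ` inside a thin tube, violates
`NeckFree r θ b`.  PROOF SKETCH (gives `14θ + 4ζ + 9ε`; stated with the round constant `20`).  Shadows `S(t) = {s : |a s − b t| ≤ ε}`
are nonempty (H1) and `θ`-small along `a` (two shadows are `2ε ≤ r`-close, `NeckFree a`); if `|b t − b t'| ≤ r − 2ε` then
`S(t) ∪ S(t')` is `θ`-small along `a` (STEP).  KEY LEMMA (no far backtrack): if `t₁ < t₂`, `p ∈ S(t₁)`, `σ ∈ S(t₂)`, `σ < p`, then
`diam a[σ,p] ≤ 12θ + 8ε + 4ζ`.  Else pick `s ∈ [σ,p]` with `a s` farther than `2θ + 2ε` from `a p, a σ` and than `θ + ζ` from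
`a 0, a 1` (exists: `a[σ,p]` is connected and the four balls have total diameter `12θ + 8ε + 4ζ`); on the interval
`K = {s' : diam a[s,s'] ≤ θ}` every point is finely visited by `b` (H2), its visit times form a `θ`-small stretch of `b` (`NeckFree b`)
not containing `t₁, t₂` (else `a s` would be `(2θ+2ε)`-close to `a p` or `a σ`), so "visited before `t₁` / between / after `t₂`" is a
well-defined colouring of `K`, locally constant (fine visitors of `r − 2ε`-close points of `a` are `r`-close on `b`), hence constant;
but the STEP-chain of shadows of `b|[t₁,t₂]` runs from `p` to `σ` through `K` (colour "between") and that of `b|[0,t₁]` runs from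
`s₀ ≤ s` (A0) to `p` through `K` (colour "before") — contradiction.  MATCHING: with `h(t) = max ⋃_{τ ≤ t} S(τ)` (monotone) and
`ℓ(t) = min ⋃_{τ ≥ t} S(τ) ≤ h(t)`, the key lemma gives `diam a[ℓ t, h t] ≤ 12θ + 8ε + 4ζ`; choose times `0 = t₀ < … < t_N = 1` with
`b`-oscillation `≤ λ ≤ r − 2ε` on each cell, `s_i = h(t_i)` (`s₀ = 0`, `s_N = 1`), the monotone piecewise-linear `ψ` through
`(t_i, s_i)` (`Curve.reparamDist_eq_zero_of_monotone'` absorbs non-strict monotonicity): on a cell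
`|a(ψ t) − b t| ≤ diam a[s_i, s_{i+1}] + |a s_{i+1} − b t_{i+1}| + λ ≤ θ + (12θ + 8ε + 4ζ + ε) + λ` (STEP; corridor), and `2θ` instead
of `θ` on the two end cells by (A0)/(A1); let `λ → 0`.
HOW THE TRANSFER USES IT (inside S10): `a` = a free arc of a macroscopic loop `u` of one configuration (cut into pieces of diameter
`≤ η/16`, so complements are big and `NeckFree` follows from the loop property), `b` = the component of the partner loop `u'` inside
the closed `ε`-tube of `a` that reaches the deep part of the tube (unique and traversing by the same colouring argument, using
`NeckFree` of `u'` off the regions); (H1) by construction, (H2) with `ζ = 3θ + 2ε`, (A0)/(A1) because tube entries of `u'` have fine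
shadows in the initial/final `θ`-arcs of `a`; orientation is fixed per arc by applying the lemma to `a` or `a.reverse`, coherence
around the loop comes from the matched routing, and `udist ≤ η` follows by gluing (`Curve.loopDist`, `UnbasedLoop.udist`). -/
def NoNeckRigidity : Prop :=
  ∀ (a b : Curve ℂ) (r θ ζ ε : ℝ), 2 * ε < r → 0 ≤ ζ → NeckFree r θ a → NeckFree r θ b →
    (∀ t, ∃ s, dist (b t) (a s) ≤ ε) →
    (∀ s, (∃ t, dist (a s) (b t) ≤ ε) ∨ dist (a s) (a 0) ≤ ζ ∨ dist (a s) (a 1) ≤ ζ) →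
    (∃ s₀, dist (b 0) (a s₀) ≤ ε ∧ Metric.diam (a '' Set.Icc 0 s₀) ≤ θ) →
    (∃ s₁, dist (b 1) (a s₁) ≤ ε ∧ Metric.diam (a '' Set.Icc s₁ 1) ≤ θ) →
    Curve.reparamDist a b ≤ 20 * (θ + ζ + ε)

/-! ## §2 Glue (sorry-free) -/

/-- The colour sequence `(T,F,T,F,F,T)` is `(T,F,T,F,F)` followed by `(T)`. -/
theorem fin_append_five_one :
    Fin.append ![true, false, true, false, false] ![true] = ![true, false, true, false, false, true] := by
  funext i
  fin_cases i <;> rfl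

/-- **The `κ` decision is enough for the good events G1/G2 on `𝕋`**: `FiveArmUpperT` (two open, three closed arms, order-free),
Reimer's sub-multiplicativity in the number of arms (`real_armEvent_append_le_mul`) and the a priori one-arm bound
(`exists_polyArmProb_one_le_rpow`) give the six-arm bound `P_{1/2}(armEvent (T,F,T,F,F,T) m n) ≤ C (m/n)² (m/n)^α`, `α > 0` — the
order-free event containing every cyclic arrangement of three open and three closed arms, in particular the alternating six-arm
event produced by three interface strands crossing an annulus. -/
theorem sixArm_le_of_fiveArmUpperT (h : FiveArmUpperT) :
    ∃ C α : ℝ, ∃ m₀ : ℕ, 0 < α ∧ ∀ m n : ℕ, m₀ ≤ m → m ≤ n →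
      (triSitePercolation half).real (armEvent ![true, false, true, false, false, true] m n) ≤
        C * (((m : ℝ) / n) ^ 2 * ((m : ℝ) / n) ^ α) := by
  obtain ⟨C, m₀, h5⟩ := h
  obtain ⟨C₁, α, -, hα, h1⟩ := exists_polyArmProb_one_le_rpow
  refine ⟨C * C₁, α, max m₀ 1, hα, fun m n hm hmn ↦ ?_⟩
  have key := real_armEvent_append_le_mul half ![true, false, true, false, false] ![true] hmn
  rw [fin_append_five_one] at key
  have h5' := h5 m n (le_of_max_le_left hm) hmn
  have h1' : (triSitePercolation half).real (armEvent ![true] m n) ≤ C₁ * ((m : ℝ) / n) ^ α :=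
    h1 true m n (le_of_max_le_right hm) hmn
  calc (triSitePercolation half).real (armEvent ![true, false, true, false, false, true] m n)
      ≤ (triSitePercolation half).real (armEvent ![true, false, true, false, false] m n) *
          (triSitePercolation half).real (armEvent ![true] m n) := key
    _ ≤ (C * ((m : ℝ) / n) ^ 2) * (C₁ * ((m : ℝ) / n) ^ α) :=
        mul_le_mul h5' h1' measureReal_nonneg (measureReal_nonneg.trans h5')
    _ = C * C₁ * (((m : ℝ) / n) ^ 2 * ((m : ℝ) / n) ^ α) := by ring

/-- **The classical two-sided form is a special case of `NoNeckRigidity`**: Hausdorff-type closeness in BOTH directions at precision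
`ε`, endpoints `ε`-close, both curves `(r, θ)`-neck-free, `2ε < r` ⇒ `reparamDist a b ≤ 20 (θ + ε)` (take `ζ = 0`, anchors `s₀ = 0`,
`s₁ = 1`).  This is the audit's D2 with the necessary two-sidedness added. -/
theorem reparamDist_le_of_noNeckRigidity (h : NoNeckRigidity) {a b : Curve ℂ} {r θ ε : ℝ} (hε : 2 * ε < r)
    (ha : NeckFree r θ a) (hb : NeckFree r θ b) (hba : ∀ t, ∃ s, dist (b t) (a s) ≤ ε)
    (hab : ∀ s, ∃ t, dist (a s) (b t) ≤ ε) (h0 : dist (a 0) (b 0) ≤ ε) (h1 : dist (a 1) (b 1) ≤ ε) :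
    Curve.reparamDist a b ≤ 20 * (θ + ε) := by
  have hε0 : 0 ≤ ε := dist_nonneg.trans h0
  have hr : 0 ≤ r := by linarith
  have hθ0 : Metric.diam (a '' Set.Icc (0 : unitInterval) 0) ≤ θ := by
    simpa [Set.uIcc_self] using ha 0 0 (by simpa using hr)
  have hθ1 : Metric.diam (a '' Set.Icc (1 : unitInterval) 1) ≤ θ := by
    simpa [Set.uIcc_self] using ha 1 1 (by simpa using hr)
  have := h a b r θ 0 ε hε le_rfl ha hb hba (fun s ↦ Or.inl (hab s))
    ⟨0, by rwa [dist_comm] at h0, hθ0⟩ ⟨1, by rwa [dist_comm] at h1, hθ1⟩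
  simpa using this

/-- **Composition of the line v3 (pure logic; registered helper, anchor of this module on the crux item)**: blind rigidity, the two
five-arm upper bounds, no-neck rigidity and the neck-tomography transfer give the crux. -/
theorem nestingRigidity_of_stubs_v3 : (MagicFormulaZ2 → MagicFormulaT → LoopLimitZ2Blind) → FiveArmUpperT → FiveArmUpperZ2 → NoNeckRigidity → (FiveArmUpperT → FiveArmUpperZ2 → NoNeckRigidity → LoopLimitZ2Blind → LoopLimitZ2EqT) → NestingRigidity :=
  fun h₁ h₅ h₆ h₉ h₁₀ hZ hT ↦ h₁₀ h₅ h₆ h₉ (h₁ hZ hT)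

end Summit.CriticalPhenomena.CardyFormulaZ2.Cruxes.NestingRigidity.PinchResampling

end
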